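import Literature.Probability.LatticeModels.ReflectedCurrents
import Literature.Probability.LatticeModels.PlusMinusReflectionInvariance
import Literature.Probability.LatticeModels.IsingThermodynamics
import Summits.CriticalPhenomena.Ising3DConformalLimit.Theorems.EnergyNotSigmaSquaredMoebiusLimitExistsDefs
import HarnessLib

/-!
# Vocabulary of line `folded-current-repulsion` for crux `ExistsScaleCovariantLimit` (stmt-CriticalPhenomena-1981)

Route `HyperoctahedralRP` / `GaussianScaleMixture` (sub-problem `CriticalPhenomena/Ising3DConformalLimit`), crux
`Summit.CriticalPhenomena.Ising3DConformalLimit.Theses.HyperoctahedralRP.ExistsScaleCovariantLimit` (item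
stmt-CriticalPhenomena-1981, shared verbatim by 14 routes). This file is the **definitions module** of the checked
skeleton `Cruxes/ExistsScaleCovariantLimit/Lines/folded_current_repulsion.lean` (crux-strategist
`planner-cstrat-stmt-CriticalPhenomena-1981-p1-0`, v1; line lead `prover-line-stmt-CriticalPhenomena-1981-c11-0`, v2/v3).
It carries, sorry-free, the line's VOCABULARY (§0: the site mirror `θ : x₀ ↦ −x₀` of `ℤ³`, the strict left half
`H₋ = Λ_L ∩ {x₀ < 0}` of the box `Λ_L = {−L,…,L}³`, the proof that `(zdGraph 3, θ, Λ_L, H₋)` is a fold datum in the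
sense of the tree's `Literature.Probability.LatticeModels.IsFoldable` (Duminil-Copin–Panis 2025 §2.2 = Aizenman 2025
Def. 14.1 "Markovian reflection"), the folded hitting weight `foldHitZ` and the folded hitting probability
`foldHitProb` of the sourced random current on the bonds of `Λ_L`) and the line's STATEMENTS (§1: `FoldedIdentity`,
`WallRepulsion`, `AxisGradientRate`, `ClusterPointUnique`), so that the stub helper files
`Theorems/HyperoctahedralRPExistsScaleCovariantLimitFoldedCurrent<Stub>.lean` (each proving `theorem <stubName> : <Statement>`
by name, `--supports stmt-CriticalPhenomena-1981`) and the closing skeleton share ONE copy of every object. NOTHING in §1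
is asserted: every `def … : Prop` there is a statement to be proved by a registered stub or by the skeleton's glue.
`FoldedIdentity` is Aizenman's folded random-current identity (M. Aizenman, *Geometric analysis of Ising models,
Part III*, Math. Phys. Anal. Geom. 28 (2025) 32 = arXiv 2509.02850, Thm 14.2 with Lemma 14.3) on the boxes;
`WallRepulsion` is the line's load-bearing research statement (equivalent, given `FoldedIdentity`, to item 6150
`MirrorHoelderCompactness.TwoPointDoubling`, i.e. to the log-free axial gradient bound of Aizenman–Duminil-Copin,
Ann. Math. 194 (2021), Remark 5.10); `ClusterPointUnique` is the uniqueness half of the crux (Duminil-Copin, ICM 2022,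
§8.4). The objects are typed over the reflected-current framework of `Literature/…/ReflectedCurrents.lean`
(currents `n : ℰ_{Λ_L} → ℕ`, `cweight`, `csources`, `currentZ`, `IsFoldable.fold`, `IsFoldable.ConnFix`), in which
the reflection-adapted switching lemma `IsFoldable.tsum_switch_reflected_eq` is already proved.
-/

noncomputable section

namespace Summit.CriticalPhenomena.Ising3DConformalLimit.Cruxes.ExistsScaleCovariantLimit.FoldedCurrentRepulsion

open Filter Finset
open scoped Topology BigOperators symmDiff ENNReal
open Literature.Probability.LatticeModels
open Summit.CriticalPhenomena.Ising3DConformalLimit.MoebiusLimitExistsOnlyInteraction (IsClusterPoint)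
open Classical

/-! ## §0 Vocabulary: the Markovian reflection of the box and the folded hitting probability -/

/-- The site mirror `θ : x₀ ↦ −x₀` of `ℤ³` (mirror plane `𝕏 = {x₀ = 0}` THROUGH SITES, so no nearest-neighbour bond is
cut: a Markovian reflection in the sense of Aizenman 2025, Def. 14.1), as a bijection of `ℤ³`. [folklore] -/
abbrev mirror : Site 3 ≃ Site 3 := (reflectCoord (d := 3) 0).toEquiv

/-- Coordinates of the mirrored site. [folklore] -/
theorem mirror_apply (x : Site 3) (j : Fin 3) : mirror x j = if j = 0 then -x j else x j :=
  reflectCoord_apply 0 x j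

/-- The zeroth coordinate of the mirrored site. [folklore] -/
@[simp] theorem mirror_apply_zero (x : Site 3) : mirror x 0 = -x 0 := by
  rw [mirror_apply, if_pos rfl]

/-- The other coordinates of the mirrored site. [folklore] -/
theorem mirror_apply_ne (x : Site 3) {j : Fin 3} (hj : j ≠ 0) : mirror x j = x j := by
  rw [mirror_apply, if_neg hj]

/-- The strict left half `H₋ = Λ_L ∩ {x₀ < 0}` of the box (Aizenman's `Λ₁ ∖ Λ₀`). [folklore] -/
def leftHalf (L : ℕ) : Finset (Site 3) := (box 3 L).filter fun x => x 0 < 0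

/-- Membership in the strict left half. [folklore] -/
theorem mem_leftHalf {L : ℕ} {x : Site 3} : x ∈ leftHalf L ↔ x ∈ box 3 L ∧ x 0 < 0 := by
  rw [leftHalf, mem_filter]

/-- The mirror preserves the centred box `Λ_L`. [folklore] -/
theorem mirror_mem_box_iff (L : ℕ) (x : Site 3) : mirror x ∈ box 3 L ↔ x ∈ box 3 L := by
  simp only [mem_box]
  constructor
  · intro h i
    have := h i
    by_cases hi : i = 0
    · subst hi; rw [mirror_apply_zero] at this; omega
    · rw [mirror_apply_ne x hi] at this; exact this
  · intro h i
    have := h i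
    by_cases hi : i = 0
    · subst hi; rw [mirror_apply_zero]; omega
    · rw [mirror_apply_ne x hi]; exact this

/-- **The Markovian reflection of the box is a fold datum** (Duminil-Copin–Panis 2025 §2.2; Aizenman 2025 Def. 14.1):
`θ` is an involutive automorphism of `ℤ³` preserving `Λ_L`; `H₋` is disjoint from `θ H₋ = Λ_L ∩ {x₀ > 0}`; every
non-fixed site of `Λ_L` lies in `H₋ ∪ θ H₋`; and no bond joins `H₋` to `θ H₋` (the plane `{x₀ = 0}` is a vertex cut).
[folklore] -/
theorem isFoldable_box (L : ℕ) : IsFoldable (zdGraph 3) mirror (box 3 L) (leftHalf L) where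
  invol := fun x => reflectCoord_reflectCoord 0 x
  adj_iff := fun x y => (reflectCoord (d := 3) 0).map_adj_iff
  mem_iff := mirror_mem_box_iff L
  left_subset := filter_subset _ _
  left_disjoint := fun x hx hθx => by
    have h1 := (mem_leftHalf.1 hx).2
    have h2 := (mem_leftHalf.1 hθx).2
    rw [mirror_apply_zero] at h2
    omega
  cover := fun x hx hne => by
    have hx0 : x 0 ≠ 0 := by
      intro h0
      apply hne
      funext j
      by_cases hj : j = 0
      · subst hj; rw [mirror_apply_zero, h0, neg_zero]
      · exact mirror_apply_ne x hj
    rcases lt_or_gt_of_ne hx0 with hlt | hgt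
    · exact Or.inl (mem_leftHalf.2 ⟨hx, hlt⟩)
    · refine Or.inr (mem_leftHalf.2 ⟨(mirror_mem_box_iff L x).2 hx, ?_⟩)
      rw [mirror_apply_zero]; omega
  no_cross := fun x hx y hxy hθy => by
    have h1 := (mem_leftHalf.1 hx).2
    have h2 := (mem_leftHalf.1 hθy).2
    rw [mirror_apply_zero] at h2
    -- nearest neighbours differ by at most one in the zeroth coordinate
    have h3 : y 0 ≤ x 0 + 1 := by
      obtain ⟨i, h | h⟩ := (zdGraph_adj_iff x y).1 hxy
      · rw [h, Pi.add_apply]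
        by_cases hi : (0 : Fin 3) = i
        · subst hi; rw [Pi.single_eq_same]
        · rw [Pi.single_eq_of_ne hi]; omega
      · rw [h, Pi.add_apply]
        by_cases hi : (0 : Fin 3) = i
        · subst hi; rw [Pi.single_eq_same]; omega
        · rw [Pi.single_eq_of_ne hi]; omega
    omega

/-- **The folded hitting weight** `Z^{xy}_{Λ_L,β}[y ⟷ 𝕏 in n + θ(n)]`: the `w_β`-weight of the currents on `ℰ_{Λ_L}` with
sources `{x} ∆ {y}` whose folded current `fold n = n₋ + θ^* n₊` joins `y` to a site of the mirror plane (Aizenman 2025,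
Thm 14.2, numerator of `ℙ^{x,y}_{Λ,β}`). [folklore] -/
def foldHitZ (L : ℕ) (β : ℝ) (x y : Site 3) : ℝ≥0∞ :=
  ∑' n : edgesIn (zdGraph 3) (box 3 L) → ℕ,
    ind (csources (zdGraph 3) (box 3 L) n = {x} ∆ {y} ∧
        CSupp (zdGraph 3) (box 3 L) (edgesIn (zdGraph 3) (box 3 L)) n) *
      cweight (zdGraph 3) (box 3 L) β n * ind ((isFoldable_box L).ConnFix ((isFoldable_box L).fold n) y)

/-- **The folded hitting probability** `P^{xy}_{Λ_L,β}[y ⟷ 𝕏 in n + θ(n)] = Z^{xy}[y ⟷ 𝕏] / Z^{xy}` (sourced random-current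
measure with sources `{x} ∆ {y}` on the bonds of `Λ_L`, free boundary condition; junk `0/0 = 0` never met for `β ≥ 0`).
[folklore] -/
def foldHitProb (L : ℕ) (β : ℝ) (x y : Site 3) : ℝ :=
  (foldHitZ L β x y).toReal /
    (currentZ (zdGraph 3) (box 3 L) β (edgesIn (zdGraph 3) (box 3 L)) ({x} ∆ {y})).toReal

/-! ## §1 The statements of the line (plain `Prop`s; nothing asserted) -/

/-- **F1 — FOLDED RANDOM-CURRENT IDENTITY ON THE BOX** (Aizenman 2025, Thm 14.2 with Lemma 14.3, free boundary condition
on `Λ_L`; provable now from the tree's `IsFoldable.tsum_switch_reflected_eq`, `IsFoldable.connFix_fold_of_sources` and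
`isingCorr_free_eq_currentZ_div`): for `β ≥ 0` and sites `x, y ∈ Λ_L` strictly on the negative side of `𝕏 = {x₀ = 0}`,
`⟨σ_x σ_{θy}⟩^∅_{Λ_L,β} = ⟨σ_x σ_y⟩^∅_{Λ_L,β} · P^{xy}_{Λ_L,β}[y ⟷ 𝕏 in n + θ(n)]`. A statement, not asserted. -/
def FoldedIdentity : Prop :=
  ∀ (L : ℕ) (β : ℝ), 0 ≤ β → ∀ x y : Site 3, x ∈ box 3 L → y ∈ box 3 L → x 0 < 0 → y 0 < 0 →
    isingTwoPoint (zdGraph 3) (box 3 L) β 0 .free x (mirror y) =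
      isingTwoPoint (zdGraph 3) (box 3 L) β 0 .free x y * foldHitProb L β x y

/-- **F2 — WALL REPULSION OF THE FOLDED CRITICAL CURRENT (the line's ENGINE; load-bearing, research).** At `β = β_c(3)`,
with the far source `x = −(k+1)e₀` and the near source `y = −e₀` ADJACENT to the mirror plane `𝕏 = {x₀ = 0}`, the folded
sourced cluster of `y` AVOIDS `𝕏` with probability at most `A/k`, for all large boxes:
`1 − P^{xy}_{Λ_L,β_c}[y ⟷ 𝕏] ≤ A/k` for `L ≥ L₀(k)`. Given `FoldedIdentity` and the thermodynamic limit this reads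
`1 − g(k+2)/g(k) ≤ A/k`, `g(n) = ⟨σ₀σ_{ne₀}⟩_{β_c}`, i.e. the log-free axial gradient bound of Aizenman–Duminil-Copin 2021,
Remark 5.10 = item 6150 `TwoPointDoubling` (`Funnel.twoPointDoubling_iff_axisGradientRate`). Random-walk analogue: gambler's
ruin (`P ≈ 2/k`). OPEN. A statement, not asserted. -/
def WallRepulsion : Prop :=
  ∃ A : ℝ, ∀ k : ℕ, 1 ≤ k → ∀ᶠ L : ℕ in atTop,
    1 - foldHitProb L (criticalBeta 3) (Pi.single 0 (-((k : ℤ) + 1))) (Pi.single 0 (-1)) ≤ A / k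

/-- **The axial gradient RATE** `g(k) − g(k+1) ≤ A·g(k)/k` — verbatim the right-hand side of
`Funnel.twoPointDoubling_iff_axisGradientRate` (item 6150 in the form of Aizenman–Duminil-Copin 2021, Remark 5.10).
A statement, not asserted. -/
def AxisGradientRate : Prop :=
  ∃ A : ℝ, ∀ k : ℕ, 1 ≤ k →
    criticalTwoPoint 3 (Pi.single 0 (k : ℤ)) - criticalTwoPoint 3 (Pi.single 0 ((k + 1 : ℕ) : ℤ)) ≤
      A * criticalTwoPoint 3 (Pi.single 0 (k : ℤ)) / k

/-- **F4 — UNIQUENESS OF THE PINNED CLUSTER POINT** (the uniqueness half of the crux; open — the split child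
`ClusterPointUnique` of the strategist's decomposition `crux ⟺ TwoPointDoubling ∧ ClusterPointUnique`): any two
locally-uniform cluster points of the pinned zoom `ρ_pin` agree off the diagonals (the UNIQUE clause of
`ExistsScaleCovariantLimitNegative.crux_iff_orbitPrecompact_and_unique`). Not funnelled into item 6150 (it quantifies over
locally-uniform cluster points only). A statement, not asserted. -/
def ClusterPointUnique : Prop :=
  ∀ S S' : CorrFamily 3, IsClusterPoint S → IsClusterPoint S' → ∀ n, Set.EqOn (S n) (S' n) (NonCoincident 3 n)

/-! ## §2 Elementary API of the objects (shared by the stub files) -/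

/-- `θ(−e₀) = e₀`. [folklore] -/
theorem mirror_neg_e0 : mirror (Pi.single 0 (-1 : ℤ)) = Pi.single 0 1 := by
  funext j
  by_cases hj : j = 0
  · subst hj; rw [mirror_apply_zero]; simp
  · rw [mirror_apply_ne _ hj]; simp [Pi.single_eq_of_ne hj]

/-- The folded hitting weight is a partial sum of `Z^{xy} = Z({x} ∆ {y})`: `Z^{xy}[y ⟷ 𝕏] ≤ Z^{xy}`. [folklore] -/
theorem foldHitZ_le_currentZ (L : ℕ) (β : ℝ) (x y : Site 3) :
    foldHitZ L β x y ≤ currentZ (zdGraph 3) (box 3 L) β (edgesIn (zdGraph 3) (box 3 L)) ({x} ∆ {y}) := by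
  unfold foldHitZ currentZ
  refine ENNReal.tsum_le_tsum fun n => ?_
  calc _ ≤ ind (csources (zdGraph 3) (box 3 L) n = {x} ∆ {y} ∧
          CSupp (zdGraph 3) (box 3 L) (edgesIn (zdGraph 3) (box 3 L)) n) * cweight (zdGraph 3) (box 3 L) β n * 1 := by
        gcongr; exact ind_le_one _
    _ = _ := mul_one _

/-- `0 ≤ P^{xy}[y ⟷ 𝕏]`. [folklore] -/
theorem foldHitProb_nonneg (L : ℕ) (β : ℝ) (x y : Site 3) : 0 ≤ foldHitProb L β x y :=
  div_nonneg ENNReal.toReal_nonneg ENNReal.toReal_nonneg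

/-- `0 ≤ P^{xy}[y ⟷ 𝕏] ≤ 1` (as a real number; the junk case `Z^{xy} = ∞` gives `0`) — registered sub-goal
`foldHitProb_mem_Icc` of the line (the elementary API its stub files share). [folklore] -/
theorem foldHitProb_mem_Icc : ∀ (L : ℕ) (β : ℝ) (x y : Site 3), foldHitProb L β x y ∈ Set.Icc (0 : ℝ) 1 := by
  intro L β x y
  refine ⟨foldHitProb_nonneg L β x y, ?_⟩
  unfold foldHitProb
  by_cases htop : currentZ (zdGraph 3) (box 3 L) β (edgesIn (zdGraph 3) (box 3 L)) ({x} ∆ {y}) = ∞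
  · rw [htop, ENNReal.toReal_top, div_zero]; exact zero_le_one
  refine div_le_one_of_le₀ ?_ ENNReal.toReal_nonneg
  exact ENNReal.toReal_mono htop (foldHitZ_le_currentZ L β x y)

end Summit.CriticalPhenomena.Ising3DConformalLimit.Cruxes.ExistsScaleCovariantLimit.FoldedCurrentRepulsion

end
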